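import Summits.Langlands.Langlands.Theses.MonomialConverse
import Literature.RepresentationTheory.FiniteGroups.DegreeZeroInduction
import Literature.RepresentationTheory.FiniteGroups.DeterminantCharacterExtension
import Literature.RepresentationTheory.FiniteGroups.ProductGroupCharacters
import Literature.RepresentationTheory.FiniteGroups.SecondOrthogonality
import Literature.RepresentationTheory.FiniteGroups.MonomialInflation
import Literature.RepresentationTheory.FiniteGroups.InductionTransitivity

/-!
# Abelian-free Brauer induction, I: the span `J(G)` and the objects of the proof

Part of the sorry-free proof of the crux `Summit.Langlands.Langlands.Theses.MonomialConverse.AbelianFreeBrauer`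
(item stmt-Langlands-18580, route-Langlands-MonomialConverse), split over the files
`MonomialConverseAbelianFreeBrauer{Span, Linear, Moves, Hubs, Affine, Expansion, Proof}` (landing
order; all definitions live in `Span`, the last file holds `abelianFreeBrauer_proof` and the proof
outline).  Everything is over the in-tree class-function library
`Literature.RepresentationTheory.FiniteGroups` (`indClassFun`, `classInner`, `virtChars`, `IsIrrChar`);
no `sorry`, no new axioms, no `Prop`-valued definitions (predicates are sets).

Contents: linear characters as homomorphisms (`isIrrChar_coe`, `coe_injective'`); the generators
`afGens G` (`Ind_H^G φ`, `φ : H →* ℂˣ` not the restriction of a linear character of `G` — the item's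
clause verbatim) and their additive span `afSpan G = J(G)`; `J ⊥ Λ`
(`classInner_coe_eq_zero_of_mem_afSpan`, Frobenius reciprocity); stability of `J` under induction from
subgroups (`indClassFun_mem_afSpan_of_mem`), inflation from quotients (`comp_mk_mem_afSpan`), twisting
by linear characters (`mul_coe_mem_afSpan`) and integer multiples; the permutation characters
`indOne K = Ind_K^G 1` (`π_K`) with `indOne_map_conj`, their values for normal `K`, `indOne_top`, and
`π_T = ∑_{β ∈ Irr(G/T)} β ∘ mk` for `G/T` commutative (`indOne_eq_sum_comp_mk`).  Then the remaining
**objects** (all definitions of the proof are in this file): the finite set `linF G` of linear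
characters as functions, the linear part `linPart G f = ∑_{χ ∈ linF G} ⟨f, χ⟩ χ`, the set
`linOrth G = R(G) ∩ Λ(G)^⊥`, the covering subgroups `coverers G` (`K·G' = G`), the hull
`hull G K = ⋂ {ker μ : K ≤ ker μ}` and the admissible remainders `admRem G adm`.

References: Serre, *Linear Representations of Finite Groups* (`SerreLinearRepresentations1977`) §7.2;
Isaacs, *Character Theory of Finite Groups* (`Isaacs1976`) Ch. 5.
-/

set_option linter.dupNamespace false

noncomputable section

open scoped BigOperators Pointwise

namespace Summit.Langlands.Langlands.Theorems.AbelianFreeBrauer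

open Literature.RepresentationTheory.FiniteGroups

variable {G : Type} [Group G]

/-! ### Linear characters as homomorphisms: small complements -/

/-- A character of degree `1` is irreducible. [folklore] -/
theorem isIrrChar_of_isCharacter_apply_one {K : Type} [Group K] {lam : K → ℂ}
    (hlam : IsCharacter K lam) (h1 : lam 1 = 1) : IsIrrChar K lam := by
  obtain ⟨V, _, _, _, ρ, rfl⟩ := hlam
  have hd : Module.finrank ℂ V = 1 := by
    have h := ρ.char_one
    rw [h1] at h
    exact_mod_cast h.symm
  exact ⟨V, _, _, inferInstance, ρ, isIrreducible_of_finrank_eq_one ρ hd, rfl⟩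

/-- The coercion `g ↦ μ(g)` of a linear character `μ : G →* ℂˣ` is an irreducible character. [folklore] -/
theorem isIrrChar_coe (μ : G →* ℂˣ) : IsIrrChar G (fun g => (μ g : ℂ)) :=
  isIrrChar_of_isCharacter_apply_one (isCharacter_coe_monoidHom' μ)
    (by simp only [map_one, Units.val_one])

/-- `μ ↦ (g ↦ μ g)` is injective. [folklore] -/
theorem coe_injective' {μ ν : G →* ℂˣ} (h : (fun g => (μ g : ℂ)) = fun g => (ν g : ℂ)) : μ = ν :=
  MonoidHom.ext fun g => Units.ext (congrFun h g)

/-! ### Abelian-free pairs and their span `J(G)` -/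

section Span

variable (G) [Fintype G]

/-- The generators `Ind_H^G φ` of `J(G)` over the **abelian-free pairs** `(H, φ)`: the linear character
`φ : H →* ℂˣ` of the subgroup `H` is not the restriction of any linear character of `G` (the clause
`∀ χ : G →* ℂˣ, χ.restrict H ≠ φ` of item stmt-Langlands-18580, verbatim). [folklore] -/
def afGens : Set (G → ℂ) :=
  {f | ∃ (H : Subgroup G) (φ : H →* ℂˣ), (∀ χ : G →* ℂˣ, χ.restrict H ≠ φ) ∧
    f = indClassFun H (fun h => (φ h : ℂ))}

/-- **`J(G)`**: the additive subgroup (`ℤ`-span) of `G → ℂ` generated by the abelian-free monomial class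
functions `Ind_H^G φ`. [folklore] -/
def afSpan : AddSubgroup (G → ℂ) :=
  AddSubgroup.closure (afGens G)

variable {G}

/-- Generators lie in `J(G)`. [folklore] -/
theorem indClassFun_mem_afSpan {H : Subgroup G} {φ : H →* ℂˣ} (hφ : ∀ χ : G →* ℂˣ, χ.restrict H ≠ φ) :
    indClassFun H (fun h => (φ h : ℂ)) ∈ afSpan G :=
  AddSubgroup.subset_closure ⟨H, φ, hφ, rfl⟩

/-- **`J(G) ⊥ Λ(G)`**: every element of `J(G)` is orthogonal to every linear character (Frobenius
reciprocity `⟨Ind_H φ, μ⟩ = ⟨φ, μ|_H⟩_H` and orthonormality on `H`, as `φ ≠ μ|_H`). [folklore] -/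
theorem classInner_coe_eq_zero_of_mem_afSpan {f : G → ℂ} (hf : f ∈ afSpan G) (μ : G →* ℂˣ) :
    classInner f (fun g => (μ g : ℂ)) = 0 := by
  classical
  refine AddSubgroup.closure_induction (p := fun g _ => classInner g (fun s => (μ s : ℂ)) = 0)
    ?_ ?_ ?_ ?_ hf
  · rintro g ⟨H, φ, hφ, rfl⟩
    rw [classInner_indClassFun_left H _ (isCharacter_coe_monoidHom' μ).isClassFun]
    have hne : (fun h : H => (φ h : ℂ)) ≠ fun x : H => ((μ.restrict H) x : ℂ) := by
      intro h
      exact hφ μ (coe_injective' h).symm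
    have key := (isIrrChar_coe φ).classInner_eq (isIrrChar_coe (μ.restrict H))
    rw [if_neg hne] at key
    exact key
  · exact classInner_zero_left _
  · intro g g' _ _ hg hg'
    rw [classInner_add_left, hg, hg', add_zero]
  · intro g _ hg
    rw [← neg_one_smul ℂ g, classInner_smul_left, hg, mul_zero]

/-- **Induction `J(K) → J(G)`** (transitivity `Ind_K^G Ind_{H₀}^K = Ind_{H₀}^G`; an abelian-free pair of
`K` stays abelian-free in `G`, restrictions from `G` being restrictions from `K`). [folklore] -/
theorem indClassFun_mem_afSpan_of_mem (K : Subgroup G) [Fintype K] {f : K → ℂ}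
    (hf : f ∈ afSpan K) : indClassFun K f ∈ afSpan G := by
  refine AddSubgroup.closure_induction (p := fun g _ => indClassFun K g ∈ afSpan G) ?_ ?_ ?_ ?_ hf
  · rintro g ⟨H₀, φ₀, hφ₀, rfl⟩
    rw [indClassFun_indClassFun_map K H₀]
    refine indClassFun_mem_afSpan (H := H₀.map K.subtype)
      (φ := φ₀.comp (Subgroup.equivMapOfInjective H₀ K.subtype K.subtype_injective).symm.toMonoidHom)
      fun χ hχ => hφ₀ (χ.restrict K) (MonoidHom.ext fun x => ?_)
    have h := DFunLike.congr_fun hχ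
      (Subgroup.equivMapOfInjective H₀ K.subtype K.subtype_injective x)
    simp only [MonoidHom.restrict_apply, MonoidHom.comp_apply, MulEquiv.coe_toMonoidHom,
      MulEquiv.symm_apply_apply, Subgroup.coe_equivMapOfInjective_apply, Subgroup.coe_subtype] at h
    simpa only [MonoidHom.restrict_apply] using h
  · rw [indClassFun_zero]
    exact zero_mem _
  · intro g g' _ _ hg hg'
    rw [indClassFun_add]
    exact add_mem hg hg'
  · intro g _ hg
    rw [indClassFun_neg]
    exact neg_mem hg

/-- **Inflation `J(G/N) → J(G)`** (`Ind_{H̄}^{G/N} φ ∘ π = Ind_{π⁻¹H̄}^G (φ ∘ π)`; a linear character of `G`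
restricting to `φ ∘ π` is trivial on `N`, so it descends to `G/N`). [folklore] -/
theorem comp_mk_mem_afSpan (N : Subgroup G) [N.Normal] [Fintype (G ⧸ N)] {f : G ⧸ N → ℂ}
    (hf : f ∈ afSpan (G ⧸ N)) : (fun g : G => f g) ∈ afSpan G := by
  refine AddSubgroup.closure_induction (p := fun ψ _ => (fun g : G => ψ g) ∈ afSpan G) ?_ (zero_mem _)
    (fun _ _ _ _ h h' => add_mem h h') (fun _ _ h => neg_mem h) hf
  rintro ψ ⟨Hb, φ, hφ, rfl⟩
  set sc := (QuotientGroup.mk' N).subgroupComap Hb with hsc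
  have hfun : (fun g : G => indClassFun Hb (fun h => (φ h : ℂ)) (g : G ⧸ N)) =
      indClassFun (Hb.comap (QuotientGroup.mk' N)) (fun h => ((φ.comp sc) h : ℂ)) := by
    funext g
    exact (indClassFun_comp_mk N Hb (fun h => (φ h : ℂ)) g).symm
  rw [hfun]
  refine indClassFun_mem_afSpan fun χ hχ => ?_
  -- `χ` is trivial on `N`
  have hker : N ≤ χ.ker := by
    intro n hn
    have hmem : n ∈ Hb.comap (QuotientGroup.mk' N) := by
      rw [Subgroup.mem_comap, QuotientGroup.mk'_apply, (QuotientGroup.eq_one_iff n).mpr hn]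
      exact Hb.one_mem
    have h1 : sc ⟨n, hmem⟩ = 1 := Subtype.ext (by
      rw [hsc, MonoidHom.subgroupComap_apply_coe, QuotientGroup.mk'_apply, OneMemClass.coe_one]
      exact (QuotientGroup.eq_one_iff n).mpr hn)
    have h := DFunLike.congr_fun hχ ⟨n, hmem⟩
    rw [MonoidHom.restrict_apply, MonoidHom.comp_apply, h1, map_one] at h
    exact h
  -- so it descends to `G/N`, where it restricts to `φ`
  refine hφ (QuotientGroup.lift N χ hker) (MonoidHom.ext fun x => ?_)
  obtain ⟨g, hg⟩ := QuotientGroup.mk_surjective (x : G ⧸ N)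
  have hmem : g ∈ Hb.comap (QuotientGroup.mk' N) := by
    rw [Subgroup.mem_comap, QuotientGroup.mk'_apply, hg]
    exact x.2
  have hx : sc ⟨g, hmem⟩ = x := Subtype.ext (by
    rw [hsc, MonoidHom.subgroupComap_apply_coe, QuotientGroup.mk'_apply, hg])
  have h := DFunLike.congr_fun hχ ⟨g, hmem⟩
  rw [MonoidHom.restrict_apply, MonoidHom.comp_apply, hx] at h
  rw [MonoidHom.restrict_apply, ← hg, QuotientGroup.lift_mk, h]

/-- **Twist**: `J(G) · μ ⊆ J(G)` for a linear character `μ` (`Ind_H φ · μ = Ind_H (φ · μ|_H)`, and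
`φ · μ|_H` is abelian-free with `φ`). [folklore] -/
theorem mul_coe_mem_afSpan {f : G → ℂ} (hf : f ∈ afSpan G) (μ : G →* ℂˣ) :
    f * (fun g => (μ g : ℂ)) ∈ afSpan G := by
  refine AddSubgroup.closure_induction (p := fun g _ => g * (fun s => (μ s : ℂ)) ∈ afSpan G)
    ?_ ?_ ?_ ?_ hf
  · rintro g ⟨H, φ, hφ, rfl⟩
    have hfun : indClassFun H (fun h => (φ h : ℂ)) * (fun s => (μ s : ℂ)) =
        indClassFun H (fun h => ((φ * μ.restrict H) h : ℂ)) := by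
      rw [← indClassFun_mul_restrict H _ (isCharacter_coe_monoidHom' μ).isClassFun]
      congr 1
    rw [hfun]
    refine indClassFun_mem_afSpan fun χ hχ => hφ (χ * μ⁻¹) (MonoidHom.ext fun x => ?_)
    have h := DFunLike.congr_fun hχ x
    rw [MonoidHom.restrict_apply, MonoidHom.mul_apply, MonoidHom.restrict_apply] at h
    rw [MonoidHom.restrict_apply, MonoidHom.mul_apply, MonoidHom.inv_apply, h, mul_inv_cancel_right]
  · rw [zero_mul]
    exact zero_mem _
  · intro g g' _ _ hg hg'
    rw [add_mul]
    exact add_mem hg hg'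
  · intro g _ hg
    rw [neg_mul]
    exact neg_mem hg

/-- `ℤ`-multiples stay in `J(G)` (with the scalar written in `ℂ`). [folklore] -/
theorem intCast_smul_mem_afSpan {f : G → ℂ} (hf : f ∈ afSpan G) (n : ℤ) : (n : ℂ) • f ∈ afSpan G := by
  rw [Int.cast_smul_eq_zsmul]
  exact AddSubgroup.zsmul_mem _ hf n

/-- The permutation character `π_K = Ind_K^G 1` as an induced class function. [folklore] -/
abbrev indOne (K : Subgroup G) : G → ℂ :=
  indClassFun K (fun _ => (1 : ℂ))

/-- **Conjugate subgroups have the same permutation character**: `π_{gKg⁻¹} = π_K`. [folklore] -/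
theorem indOne_map_conj (K : Subgroup G) (g : G) :
    indOne (K.map (MulAut.conj g).toMonoidHom) = indOne K :=
  indClassFun_map_conj K g _ _ fun _ _ _ => rfl

/-- `π_K ∈ R(G)`. [folklore] -/
theorem indOne_mem_virtChars (K : Subgroup G) : indOne K ∈ virtChars G := by
  classical
  exact indClassFun_mem_virtChars K (Subring.one_mem _)


/-- `π_T(g) = [G:T]` for `g ∈ T`, `T` normal. [folklore] -/
theorem indOne_apply_of_mem (T : Subgroup G) [hT : T.Normal] {g : G} (hg : g ∈ T) :
    indOne T g = (T.index : ℂ) := by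
  rw [indOne, indClassFun_apply]
  have h : ∀ t : G, Function.extend (Subtype.val : T → G) (fun _ : T => (1 : ℂ)) 0 (t⁻¹ * g * t) = 1 :=
    fun t => extend_subtypeVal_apply (H := T) (φ := fun _ : T => (1 : ℂ)) ⟨t⁻¹ * g * t, hT.conj_mem' g hg t⟩
  simp only [h, Finset.sum_const, Finset.card_univ, nsmul_eq_mul, mul_one]
  have hc : (Fintype.card G : ℂ) = (Nat.card T : ℂ) * (T.index : ℂ) := by
    rw [← Nat.card_eq_fintype_card, ← T.card_mul_index, Nat.cast_mul]
  have hT0 : (Nat.card T : ℂ) ≠ 0 := Nat.cast_ne_zero.mpr Nat.card_pos.ne'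
  rw [hc, ← mul_assoc, inv_mul_cancel₀ hT0, one_mul]

/-- `π_T(g) = 0` for `g ∉ T`, `T` normal. [folklore] -/
theorem indOne_apply_of_not_mem (T : Subgroup G) [hT : T.Normal] {g : G} (hg : g ∉ T) :
    indOne T g = 0 := by
  rw [indOne, indClassFun_apply]
  refine mul_eq_zero_of_right _ (Finset.sum_eq_zero fun t _ => ?_)
  refine extend_subtypeVal_of_not_mem (H := T) (φ := fun _ : T => (1 : ℂ)) fun h => hg ?_
  have h' := hT.conj_mem _ h t
  rwa [show t * (t⁻¹ * g * t) * t⁻¹ = g by group] at h'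

/-- `π_⊤ = 1`. [folklore] -/
theorem indOne_top : indOne (⊤ : Subgroup G) = (1 : G → ℂ) := by
  funext s
  rw [indOne_apply_of_mem ⊤ (Subgroup.mem_top s), Subgroup.index_top, Nat.cast_one, Pi.one_apply]

/-- **`π_T = Σ_{β ∈ Irr(G/T)} β ∘ π`** for `T` normal with commutative quotient (the regular character
of `G/T`, inflated). [folklore] -/
theorem indOne_eq_sum_comp_mk (T : Subgroup G) [T.Normal] (hc : IsMulCommutative (G ⧸ T)) :
    indOne T = ∑ β ∈ (irrChars_finite_holds (G ⧸ T)).toFinset, (β ∘ (QuotientGroup.mk : G → G ⧸ T)) := by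
  classical
  haveI := hc
  funext g
  rw [Finset.sum_apply]
  simp only [Function.comp_apply]
  rw [sum_irrChars_apply, character_leftRegular, ← Nat.card_eq_fintype_card, ← Subgroup.index_eq_card]
  by_cases hg : g ∈ T
  · rw [indOne_apply_of_mem T hg, if_pos ((QuotientGroup.eq_one_iff g).mpr hg)]
  · rw [indOne_apply_of_not_mem T hg, if_neg (fun h => hg ((QuotientGroup.eq_one_iff g).mp h))]

end Span

/-! ### The remaining objects: linear characters as functions, the linear part, `linOrth`,
coverers, hulls, admissible remainders -/

section Objects

variable (G) [Fintype G]

/-- The **linear characters** of `G` as functions: irreducible characters of degree `1`. [folklore] -/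
def linF : Finset (G → ℂ) :=
  (irrChars_finite_holds G).toFinset.filter (fun χ => χ 1 = 1)

/-- **The linear part** `linPart f = ∑_{χ linear} ⟨f, χ⟩ χ` of a function `f : G → ℂ`. [folklore] -/
def linPart (f : G → ℂ) : G → ℂ :=
  ∑ χ ∈ linF G, classInner f χ • χ

/-- The virtual characters orthogonal to every linear character (`R(G) ∩ Λ(G)^⊥`). `AFB⁰(G)` is the
inclusion `linOrth G ⊆ afSpan G`. [folklore] -/
def linOrth : Set (G → ℂ) :=
  {f | f ∈ virtChars G ∧ ∀ χ ∈ linF G, classInner f χ = 0}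

/-- **The covering subgroups** `K` of `G`: every linear character trivial on `K` is trivial ("`KG' = G`").
[folklore] -/
def coverers : Set (Subgroup G) :=
  {K | ∀ μ : G →* ℂˣ, K ≤ μ.ker → μ = 1}

/-- **`hull K = ⋂_{μ linear, K ≤ ker μ} ker μ`** (`= KG'`). [folklore] -/
def hull (K : Subgroup G) : Subgroup G :=
  ⨅ μ : G →* ℂˣ, ⨅ (_ : K ≤ μ.ker), μ.ker

/-- `admRem adm`: the functions congruent modulo `J(G)` to a `ℤ`-combination of twisted
permutation characters `π_K · μ` with `K ∈ adm` and `μ` linear. [folklore] -/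
def admRem (adm : Set (Subgroup G)) : Set (G → ℂ) :=
  {f | ∃ (ι : Type) (_ : Fintype ι) (c : ι → ℤ) (μ : ι → (G →* ℂˣ)) (K : ι → Subgroup G),
    (∀ i, K i ∈ adm) ∧ f - ∑ i, (c i : ℂ) • (indOne (K i) * fun g => (μ i g : ℂ)) ∈ afSpan G}

end Objects

end Summit.Langlands.Langlands.Theorems.AbelianFreeBrauer

end
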